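import Mathlib
import Summits.NavierStokesRegularity.NavierStokesRegularity.Theorems.EulerZoomLiouvillePowerGaugeEulerLiouvilleSelfSimilarSwirlBudgetScale
import Summits.NavierStokesRegularity.NavierStokesRegularity.Theorems.EulerZoomLiouvillePowerGaugeEulerLiouvilleNeedleRaceMember
import HarnessLib

/-!
# Crux E `PowerGaugeEulerLiouville` (stmt-NavierStokesRegularity-19832), THE ONE STATEMENT `stub_selfSimilarC2Needle`, target T1:
# «THE AXISYMMETRIC NEEDLE HAS NO SWIRL» (5/5) — THE THEOREM: budgets A and E alone forbid swirl; MEMBER: every axisymmetric `C²` member is trivial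
# (width seat ns-ezl-w3 g4; closes target T1 of LEAD ns-typeII-p2's RESIDUE-MEMO-19832 §2, `Loc.selfSimilar_ae_eq_zero_of_axisymC2_profile`)

Route №10 `EulerZoomLiouville` (NavierStokesRegularity), crux E; LEAD ns-typeII-p2 g12.

* **`SwirlBudget.hasNoSwirl_of_budgets`** — `(U, P)` a `C²` self-similar Euler profile (CIV (3.3), `W = γy + U`) with `0 < γ < ½`, `U` AXISYMMETRIC, and ONLY
  the two far-field budgets `∫_{B_L}‖U‖² ≤ C_A L^p` (`p < 3`) and `∫_{B_L}‖DU‖² ≤ C_E L^q` (`q < 1`) for `L ≥ 1` ⇒ `U` is SWIRL-FREE.  No growth hypothesis, no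
  integrability of the swirl, no clock.  Proof (budgets-only capacity at the swirl maximum): at scale `L` choose by Chebyshev (`NeedleThinness.exists_good_slice`)
  a quiet radius `R ∈ (L, 2L)` and quiet heights `H₂ ∈ (2L, 4L)`, `H₁ ∈ (−4L, −2L)` (small truncated plane / cylinder integrals of `‖U‖²`, `‖DU‖²`, through
  `lintegral_eq_lintegral_cartesian` / `lintegral_eq_lintegral_cylindrical_radial`); the maximum of `Γ²` over the solid cylinder `K = {r ≤ R, H₁ ≤ z ≤ H₂}`
  (`⊇ B̄_L`) sits at a strict-inflow boundary point `a` (`swirlMax_cylinder_trichotomy`), WLOG `a = (r_a, 0, z_a)` (rotation); LATERAL is impossible for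
  large `L` (`lateral_face_estimate`: `πγ²L³ < πL‖U a‖² ≤ 4X_A/L² + 36 L X_E`); TOP/BOTTOM give `‖U a‖ > 2γL` and (`top_face_estimate`)
  `r_a L ‖U a‖² ≤ 2X_A/L + 6L X_E`, whence `max_{B̄_L} |Γ| ≤ |Γ(a)| ≤ r_a‖U a‖ ≤ X_A/(γL³) + 3X_E/(γL) → 0` (`X_A = C_A(6L)^p + 1`, `X_E = C_E(6L)^q + 1`).
* **`SwirlBudget.selfSimilar_ae_eq_zero_of_axisymC2`** — MEMBER FORM: crux binders verbatim (`0 < ρ ≤ ½`; suitable weak Euler pair on `(−∞,0) × ℝ³`, weak gradient `H`,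
  gauges `a^{2ρ}A + a^{ρ}E + a^{2ρ}D ≤ c`) + exactly self-similar ansatz about the origin at `γ = 1/(2+ρ)` + `ContDiff ℝ 2 V` + `IsAxisymmetric V` ⇒ `u = 0` a.e.
  (budgets `profile_energy_growth_of_gaugeA` (`p = 1−2ρ`) and `NeedleThinCore.selfSimilar_needle_inputs` + `NeedleRace.lintegral_fderiv_sq_ball_le` (`q = 1−ρ`);
  then `hasNoSwirl_of_budgets` and the unconditional (S37) `NeedleRace.selfSimilar_ae_eq_zero_of_axisymNoSwirlC2`).  With g3's any-axis transport
  (`ClassIsometry.selfSimilar_ae_eq_zero_of_conj`) the binder (N4″) «about no axis is `V` axisymmetric with `IsTameSwirl`» of THE ONE STATEMENT loses its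
  `IsTameSwirl` clause: the `C²` needle is NOT axisymmetric about any axis.

In print: Chae (CMP 2007, Thm 2.2 + Note added) excludes self-similar axisymmetric swirl under `rV^θ ∈ L^{p₁} ∩ L^{p₂}`; CIV 2026 §4 study the meridional flow.  Here the
swirl is excluded from the two energy budgets of the class alone.  WHAT THIS IS NOT: not NS regularity, not the crux E — a portrait stratum of THE ONE STATEMENT of
the crux CLASS 19832 (MODEL lattice; E/NS strata), `--supports` stmt-19832; every NON-axisymmetric `C²` needle stays OPEN; 19832 OPEN.
[cite: Chae2007CMPEuler, Thm 2.2 + Note added p. 6; ConstantinIgnatovaVicol2026Putative, §4.4 proof of Thm 4.6; CaffarelliKohnNirenberg1982, §2]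
-/

noncomputable section

-- flat `Theorems/<Route><Decl>…` files of one crux share the namespace of the crux (tree convention: `Summit.<S>.<S>.…`)
set_option linter.dupNamespace false

open MeasureTheory Set Filter Topology Metric Function InnerProductSpace
open scoped RealInnerProductSpace NNReal ENNReal ContDiff

namespace Summit.NavierStokesRegularity.NavierStokesRegularity.Theorems.PowerGaugeEulerLiouville

namespace SwirlBudget

open Literature.Analysis Literature.Analysis.FluidPDE Literature.Analysis.FunctionSpaces

variable {γ : ℝ} {U : EuclideanSpace ℝ (Fin 3) → EuclideanSpace ℝ (Fin 3)} {P : EuclideanSpace ℝ (Fin 3) → ℝ}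

/-! ### The theorem -/

/-- Decay of a budget ratio: `(C (6L)^e + 1)/L^k → 0` as `L → ∞` when `e < k`, `0 < k`. [folklore] -/
theorem tendsto_budget_ratio {C e k : ℝ} (hek : e < k) (hk : 0 < k) :
    Tendsto (fun L : ℝ => (C * (6 * L) ^ e + 1) / L ^ k) atTop (𝓝 0) := by
  have h1 : Tendsto (fun L : ℝ => L ^ (e - k)) atTop (𝓝 0) := by
    rw [show e - k = -(k - e) by ring]; exact tendsto_rpow_neg_atTop (by linarith)
  have h2 : Tendsto (fun L : ℝ => L ^ (-k)) atTop (𝓝 0) := tendsto_rpow_neg_atTop hk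
  have h3 : Tendsto (fun L : ℝ => C * 6 ^ e * L ^ (e - k) + L ^ (-k)) atTop (𝓝 (C * 6 ^ e * 0 + 0)) :=
    (h1.const_mul _).add h2
  rw [mul_zero, zero_add] at h3
  refine h3.congr' ?_
  filter_upwards [eventually_gt_atTop 0] with L hL
  have hLk : L ^ k ≠ 0 := (Real.rpow_pos_of_pos hL k).ne'
  rw [Real.mul_rpow (by norm_num) hL.le, Real.rpow_sub hL, Real.rpow_neg hL.le, eq_div_iff hLk]
  field_simp

/-- **THE AXISYMMETRIC NEEDLE HAS NO SWIRL.**  `(U, P)` a `C²` self-similar Euler profile (CIV (3.3): `(1−γ)U + (W·∇)U + ∇P = 0`, `div U = 0`, `W = γy + U`) with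
`0 < γ < ½`, `U` AXISYMMETRIC, and the two far-field budgets `∫_{B_L}‖U‖² ≤ C_A L^p` (`p < 3`), `∫_{B_L}‖DU‖² ≤ C_E L^q` (`q < 1`) for all `L ≥ 1` (the class values:
`p = 1−2ρ`, `q = 1−ρ`).  Then `U` is SWIRL-FREE: `rU_θ ≡ 0`.  No growth, no integrability of the swirl, no clock: by `abs_swirl_le_of_scale` at every large scale
`|Γ(y)| ≤ X_A/(γL³) + 3X_E/(γL)` with `X_A = C_A(6L)^p + 1`, `X_E = C_E(6L)^q + 1`, and the right side tends to `0`. [cite: Chae2007CMPEuler, Thm 2.2 + Note added p. 6] -/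
theorem hasNoSwirl_of_budgets (h : IsSelfSimilarEulerProfile γ 0 U P) (hU : IsAxisymmetric U) (hγ0 : 0 < γ) (hγ2 : γ < 1 / 2)
    {CA CE p q : ℝ} (hCA : 0 ≤ CA) (hCE : 0 ≤ CE) (hp : p < 3) (hq : q < 1)
    (hA : ∀ L : ℝ, 1 ≤ L → ∫⁻ y in ball (0 : EuclideanSpace ℝ (Fin 3)) L, ‖U y‖ₑ ^ 2 ≤ ENNReal.ofReal (CA * L ^ p))
    (hE : ∀ L : ℝ, 1 ≤ L → ∫⁻ y in ball (0 : EuclideanSpace ℝ (Fin 3)) L, ‖fderiv ℝ U y‖ₑ ^ 2 ≤ ENNReal.ofReal (CE * L ^ q)) :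
    HasNoSwirl U := by
  intro y
  -- the scale budgets and their ratios
  set XA : ℝ → ℝ := fun L => CA * (6 * L) ^ p + 1 with hXA
  set XE : ℝ → ℝ := fun L => CE * (6 * L) ^ q + 1 with hXE
  have hXA0 : ∀ L, 0 ≤ L → 0 < XA L := fun L hL => by
    have : 0 ≤ CA * (6 * L) ^ p := mul_nonneg hCA (Real.rpow_nonneg (by positivity) _)
    simp only [hXA]; linarith
  have hXE0 : ∀ L, 0 ≤ L → 0 < XE L := fun L hL => by
    have : 0 ≤ CE * (6 * L) ^ q := mul_nonneg hCE (Real.rpow_nonneg (by positivity) _)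
    simp only [hXE]; linarith
  -- (a) the bound of one scale tends to zero
  have hδ : Tendsto (fun L : ℝ => 1 / γ * (XA L / L ^ ((3 : ℕ) : ℝ)) + 3 / γ * (XE L / L ^ ((1 : ℕ) : ℝ))) atTop (𝓝 0) := by
    have h1 := (tendsto_budget_ratio (C := CA) (by push_cast; linarith : p < ((3 : ℕ) : ℝ)) (by norm_num)).const_mul (1 / γ)
    have h2 := (tendsto_budget_ratio (C := CE) (by push_cast; linarith : q < ((1 : ℕ) : ℝ)) (by norm_num)).const_mul (3 / γ)
    have h3 := h1.add h2
    rw [mul_zero, mul_zero, add_zero] at h3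
    exact h3
  -- (b) the largeness condition holds eventually: `(4X_A/L² + 36 L X_E)/L³ → 0 < πγ²`
  have hbig : ∀ᶠ L : ℝ in atTop, 4 * XA L / L ^ 2 + 36 * L * XE L ≤ Real.pi * γ ^ 2 * L ^ 3 := by
    have h1 := (tendsto_budget_ratio (C := CA) (by push_cast; linarith : p < ((5 : ℕ) : ℝ)) (by norm_num)).const_mul 4
    have h2 := (tendsto_budget_ratio (C := CE) (by push_cast; linarith : q < ((2 : ℕ) : ℝ)) (by norm_num)).const_mul 36
    have h3 := h1.add h2
    rw [mul_zero, mul_zero, add_zero] at h3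
    have hπ : (0 : ℝ) < Real.pi * γ ^ 2 := by positivity
    filter_upwards [h3.eventually (gt_mem_nhds hπ), eventually_gt_atTop 0] with L hL hL0
    rw [Real.rpow_natCast, Real.rpow_natCast] at hL
    -- `4 X_A/L⁵ + 36 X_E/L² < πγ²`; multiply by `L³`
    have key := mul_le_mul_of_nonneg_right hL.le (pow_nonneg hL0.le 3)
    have e : (4 * (XA L / L ^ 5) + 36 * (XE L / L ^ 2)) * L ^ 3 = 4 * XA L / L ^ 2 + 36 * L * XE L := by
      field_simp
    rw [e] at key
    exact key
  -- (c) at every large scale, `|Γ(y)|` is under the bound of one scale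
  have hev : ∀ᶠ L : ℝ in atTop, |swirl U y| ≤ 1 / γ * (XA L / L ^ ((3 : ℕ) : ℝ)) + 3 / γ * (XE L / L ^ ((1 : ℕ) : ℝ)) := by
    filter_upwards [hbig, eventually_ge_atTop (max 1 ‖y‖)] with L hbigL hL
    have hL1 : 1 ≤ L := (le_max_left _ _).trans hL
    have hL0 : 0 < L := by linarith
    have hyL : ‖y‖ ≤ L := (le_max_right _ _).trans hL
    have h6L : 1 ≤ 6 * L := by linarith
    have hA' : ∫⁻ y in ball (0 : EuclideanSpace ℝ (Fin 3)) (6 * L), ‖U y‖ₑ ^ 2 ≤ ENNReal.ofReal (XA L) :=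
      (hA (6 * L) h6L).trans (ENNReal.ofReal_le_ofReal (by simp only [hXA]; linarith))
    have hE' : ∫⁻ y in ball (0 : EuclideanSpace ℝ (Fin 3)) (6 * L), ‖fderiv ℝ U y‖ₑ ^ 2 ≤ ENNReal.ofReal (XE L) :=
      (hE (6 * L) h6L).trans (ENNReal.ofReal_le_ofReal (by simp only [hXE]; linarith))
    have hb := abs_swirl_le_of_scale h hU hγ0 hγ2 hL1 (hXA0 L hL0.le) (hXE0 L hL0.le) hA' hE' hbigL hyL
    rw [Real.rpow_natCast, Real.rpow_natCast, pow_one]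
    have e : XA L / (γ * L ^ 3) + 3 * XE L / (γ * L) = 1 / γ * (XA L / L ^ 3) + 3 / γ * (XE L / L) := by
      field_simp
    rw [← e]
    exact hb
  have h0 : |swirl U y| ≤ 0 := ge_of_tendsto hδ hev
  exact abs_eq_zero.1 (le_antisymm h0 (abs_nonneg _))

/-! ### Member form -/

variable {u : ℝ → EuclideanSpace ℝ (Fin 3) → EuclideanSpace ℝ (Fin 3)} {p : ℝ → EuclideanSpace ℝ (Fin 3) → ℝ}
  {H : ℝ → EuclideanSpace ℝ (Fin 3) → EuclideanSpace ℝ (Fin 3) →L[ℝ] EuclideanSpace ℝ (Fin 3)} {c : ℝ≥0}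
  {V : EuclideanSpace ℝ (Fin 3) → EuclideanSpace ℝ (Fin 3)} {Q : EuclideanSpace ℝ (Fin 3) → ℝ}

/-- **MEMBER FORM: AN EXACTLY SELF-SIMILAR MEMBER WITH AN AXISYMMETRIC `C²` PROFILE IS TRIVIAL — swirl or no swirl.**  Crux binders verbatim (`0 < ρ ≤ ½`; suitable weak
Euler on `(−∞,0) × ℝ³`, weak gradient `H`, gauges `a^{2ρ}A + a^{ρ}E + a^{2ρ}D ≤ c`) + the exactly self-similar ansatz about the origin at the class rate `γ = 1/(2+ρ)` +
`ContDiff ℝ 2 V` + `IsAxisymmetric V` ⇒ `u = 0` a.e.  (A classical pressure exists — `WeakToClassical.exists_isSelfSimilarEulerProfile_of_contDiff`; the budgets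
`∫_{B_L}‖V‖² ≤ c L^{1−2ρ}` (`profile_energy_growth_of_gaugeA`) and `∫_{B_L}‖DV‖² ≤ E L^{1−ρ}` (`NeedleThinCore.selfSimilar_needle_inputs`, `NeedleRace.lintegral_fderiv_sq_ball_le`);
`hasNoSwirl_of_budgets`; then the unconditional (S37) `NeedleRace.selfSimilar_ae_eq_zero_of_axisymNoSwirlC2`.)  Supersedes, inside THE ONE STATEMENT, every
`IsTameSwirl` alternative of the axisymmetric binder (g3's `SwirlRatchet.selfSimilar_ae_eq_zero_of_axisym_*`). [cite: Chae2007CMPEuler, Thm 2.2 + Note added p. 6;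
CaffarelliKohnNirenberg1982, §2] -/
theorem selfSimilar_ae_eq_zero_of_axisymC2 {ρ : ℝ} (hρ : 0 < ρ) (hρ1 : ρ ≤ 1 / 2)
    (hsw : IsSuitableWeakSolutionOn (slab (EuclideanSpace ℝ (Fin 3)) (Iio 0) isOpen_Iio) 0 0 u p)
    (hH : HasWeakSpatialGradientOn (slab (EuclideanSpace ℝ (Fin 3)) (Iio 0) isOpen_Iio) u H)
    (hgauge : ∀ a : ℝ, 0 < a →
      ENNReal.ofReal (a ^ (2 * ρ)) * cknA a (0 : ℝ × EuclideanSpace ℝ (Fin 3)) u +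
          ENNReal.ofReal (a ^ ρ) * cknE a (0 : ℝ × EuclideanSpace ℝ (Fin 3)) H +
        ENNReal.ofReal (a ^ (2 * ρ)) * cknD a (0 : ℝ × EuclideanSpace ℝ (Fin 3)) p ≤ (c : ENNReal))
    (hu : ∀ τ : ℝ, τ < 0 → u τ = selfSimilarCollapse (1 / (2 + ρ)) 0 V τ)
    (hp : ∀ τ : ℝ, τ < 0 → p τ = selfSimilarCollapsePressure (1 / (2 + ρ)) 0 Q τ)
    (hV : ContDiff ℝ 2 V) (hax : IsAxisymmetric V) :
    uncurry u =ᵐ[volume.restrict (Iio (0 : ℝ) ×ˢ (univ : Set (EuclideanSpace ℝ (Fin 3))))] 0 := by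
  -- boilerplate adapted from `SwirlRatchet.selfSimilar_ae_eq_zero_of_axisym_boundedSwirl_C2` / `NeedleRace.selfSimilar_ae_eq_zero_of_axisymNoSwirl_thinFastExits`
  have hρ1' : ρ < 1 := by linarith
  have h2ρ : (0 : ℝ) < 2 + ρ := by linarith
  have hγ0 : (0 : ℝ) < 1 / (2 + ρ) := one_div_pos.2 h2ρ
  have hγ2 : 1 / (2 + ρ) < 1 / 2 := one_div_lt_one_div_of_lt two_pos (by linarith)
  have hA : ∀ a : ℝ, 0 < a → ENNReal.ofReal (a ^ (2 * ρ)) *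
      cknA a (0 : ℝ × EuclideanSpace ℝ (Fin 3)) u ≤ (c : ℝ≥0∞) :=
    fun a ha => le_trans (le_trans le_self_add le_self_add) (hgauge a ha)
  have hD : ∀ a : ℝ, 0 < a → ENNReal.ofReal (a ^ (2 * ρ)) *
      cknD a (0 : ℝ × EuclideanSpace ℝ (Fin 3)) p ≤ (c : ENNReal) :=
    fun a ha => le_trans le_add_self (hgauge a ha)
  have hpm : AEStronglyMeasurable (uncurry p)
      (volume.restrict (Iio (0 : ℝ) ×ˢ (univ : Set (EuclideanSpace ℝ (Fin 3))))) := by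
    have := hsw.distributional.2.2.1.aestronglyMeasurable
    simpa [slab] using this
  have hPm := aestronglyMeasurable_pressureProfile hpm hp
  have hDprof := profile_pressure_weight_of_gaugeD hρ hρ1' hpm hp hD
  have hP1 : LocallyIntegrable Q volume :=
    EnergySaturation.locallyIntegrable_pressure_of_weight hρ1' hPm
      (ENNReal.mul_ne_top ENNReal.ofReal_ne_top ENNReal.coe_ne_top) hDprof
  obtain ⟨P', hprof⟩ := WeakToClassical.exists_isSelfSimilarEulerProfile_of_contDiff hsw.distributional hu hp hV hP1
  -- the `A`-budget of the profile: `∫_{B_L} ‖V‖² ≤ c L^{1−2ρ}`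
  have hAV : ∀ L : ℝ, 1 ≤ L → ∫⁻ y in ball (0 : EuclideanSpace ℝ (Fin 3)) L, ‖V y‖ₑ ^ 2 ≤
      ENNReal.ofReal ((c : ℝ) * L ^ (1 - 2 * ρ)) := by
    intro L hL
    have h1 := profile_energy_growth_of_gaugeA hρ hu hA L (by linarith)
    rwa [← ENNReal.ofReal_coe_nnreal, ← ENNReal.ofReal_mul c.coe_nonneg] at h1
  -- the `E`-budget of the profile: `∫_{B_L} ‖DV‖² ≤ E L^{1−ρ}`, `E = (1−ρ)/(2+ρ)·c`
  obtain ⟨-, hEw⟩ := NeedleThinCore.selfSimilar_needle_inputs hρ hρ1' hsw hH hgauge hu hp (hV.of_le one_le_two)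
  have hE0 : 0 ≤ (1 - ρ) / (2 + ρ) * (c : ℝ) := by
    have : 0 ≤ 1 - ρ := by linarith
    positivity
  have hEV : ∀ L : ℝ, 1 ≤ L → ∫⁻ y in ball (0 : EuclideanSpace ℝ (Fin 3)) L, ‖fderiv ℝ V y‖ₑ ^ 2 ≤
      ENNReal.ofReal ((1 - ρ) / (2 + ρ) * (c : ℝ) * L ^ (1 - ρ)) :=
    fun L hL => NeedleRace.lintegral_fderiv_sq_ball_le hρ1' hE0 hEw hL
  -- no swirl, by the budgets alone
  have hns : HasNoSwirl V :=
    hasNoSwirl_of_budgets hprof hax hγ0 hγ2 c.coe_nonneg hE0 (by linarith : 1 - 2 * ρ < 3) (by linarith : 1 - ρ < 1) hAV hEV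
  -- (S37) unconditional
  exact NeedleRace.selfSimilar_ae_eq_zero_of_axisymNoSwirlC2 hρ hρ1 hsw hH hgauge hu hp hV hax hns

end SwirlBudget

end Summit.NavierStokesRegularity.NavierStokesRegularity.Theorems.PowerGaugeEulerLiouville

end
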